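import Summits.Ventures.CertifiedManyBodySolver.Certificates.HubbardSquare_afChord_CCOCNickelatesHg
import Summits.Ventures.CertifiedManyBodySolver.Downfold.BoxesCCOC
import Summits.Ventures.CertifiedManyBodySolver.Downfold.BoxesLa214V110Controls
import Summits.Ventures.CertifiedManyBodySolver.Downfold.ThermalAnnexSeam
import HarnessLib

/-!
# HYPOTHESIS-FREE T-AXIS WORDS ON THE HOLE-DOPED OBJECT-M BOXES (La-214 x = 1/8 v1.10, Na-CCOC x = 0.10): the CLOSED object-M cell words
# (`sw_afc_la214M_M15v110_word`, `sw_afc_ccocM_M36_word`) through `ThermalAnnexSeam.holdsOn_thermalAnnex_of_cellWord` — `t–t′` TRUNCATION of the member, flagged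

Venture CertifiedManyBodySolver, cell `pub/hubbard-downfold` (stage S1 ↔ S2 seam, D-0099 T axis), seat hubbard-downfold-mod-1; namespace
`Summit.Ventures.CertifiedManyBodySolver.Downfold`. Object-M companion of `BoxesThermalAnnexClosed{La214,CCOCHg,Nickelates}.lean` (object E). For every temperature cell `Θ`
(`0 < kT₁`), member, `β' ≥ p t_eV/kT`, torus-limit canonical-SECTOR Gibbs state of `H(1, p tp/t, p U/t)`: `e(ω) ∈ [F, C + 1.3863·kT₂/t₁]`:
* `boxLa214M_M15v110_ttPrimeThermalAnnex_closed`: [-1.6068078874, -0.4120625551 + 1.3863·kT₂/(39/100)] — `300 K` cap **-0.3196425551**, `100 K` **-0.3811374012**;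
* `boxCCOCM_M36_ttPrimeThermalAnnex_closed`: [-1.6057583347, -0.3867404523 + 1.3863·kT₂/(21/50)] — `300 K` cap **-0.3009218808**, `100 K` **-0.3580242380**.
HONEST FRAMING — the Hamiltonian is the member's `t–t′` TRUNCATION (object M carries `tpp/t` up to 0.14 / 0.179 and a small `tperp/t`; the tree has no thermal `t″`
seam — at `T = 0` the kinematic seam prices `t″`; a Gibbs analogue is NOT claimed); energy windows (density-keyed sector-Gibbs torus limits) in units of the member's `t`;
no hypothesis of any kind; nothing here is a phase sentence, an order word or a `T_c`. Everything is PROVED; no definition, no `sorry`.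
-/

noncomputable section

namespace Summit.Ventures.CertifiedManyBodySolver.Downfold

open NonemptyInterval Literature.MathematicalPhysics.QuantumLattice
  Literature.MathematicalPhysics.QuantumLattice.ThermodynamicLimit
  Literature.MathematicalPhysics.QuantumLattice.InfVolFermionState
  Literature.Probability.LatticeModels _root_.Filter
  Summit.Ventures.CertifiedManyBodySolver.Certificates

open scoped ComplexOrder

/-- **HYPOTHESIS-FREE typed T-axis word on `boxLa214M_M15v110`** (La₁.₈₇₅Sr₀.₁₂₅CuO₄ OBJECT M (M15 v1.10; tp/t ∈ [−0.17, −0.03], tpp/t ∈ [0.039, 0.14]); `t₁ = 39/100` eV), `t–t′` TRUNCATION of the member (object M carries `t″`; no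
thermal `t″` seam): for every temperature cell `Θ` (`0 < kT₁`), `kT ∈ Θ`, member `p`, `β' ≥ p t_eV/kT`, every torus-limit sector-Gibbs state of `H(1, p tp/t, p U/t)` at `β'`:
**`e(ω) ∈ [-1.6068078874, -0.4120625551 + 1.3863/((39/100)/kT₂)]`** (`T ≤ 300 K`: cap -0.3196425551; `100 K`: -0.3811374012) — the CLOSED `T = 0` word `sw_afc_la214M_M15v110_word` through
`holdsOn_thermalAnnex_of_cellWord`. [cite: Israel1979, Thm. I.3.4] [cite: Ruelle1969, §2.5–2.6] -/
theorem boxLa214M_M15v110_ttPrimeThermalAnnex_closed {Θ : NonemptyInterval ℚ} (hΘ : 0 < Θ.fst) {kT : ℝ} (hk : kT ∈ Θ.ratCast ℝ) :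
    HoldsOn (fun p : OneBandCoord → ℝ => ∀ β' : ℝ, p .tEV / kT ≤ β' →
      ∀ (ω : InfVolFermionState 2) (Ls : ℕ → ℕ), Tendsto Ls atTop atTop →
        ω.IsTorusLimitOfMixture (sectorGibbsCount (p .filling))
          (fun L => sectorGibbsWeightTT' β' 1 (p .tpOverT) (p .UOverT) (p .filling) L)
          (fun L => sectorGibbsVectorTT' 1 (p .tpOverT) (p .UOverT) (p .filling) L) Ls →
        ω.meanEnergy (hubbardTTPrimeFermionInteraction 1 (p .tpOverT) (p .UOverT)) 1 ∈
          Set.Icc (-1.6068078874 : ℝ) ((-0.4120625551 : ℝ) + 1.3863 / ((((39/100 : ℚ) / Θ.snd : ℚ)) : ℝ))) boxLa214M_M15v110 :=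
  holdsOn_thermalAnnex_of_cellWord (B := boxLa214M_M15v110) (eU := la214M_v110_U) (eS := la214M_M15v19_tp) (eN := la214M_M15v19_n) (eT := la214M_M15v19_t) boxLa214M_M15v110_U boxLa214M_M15v110_tp boxLa214M_M15v110_n (by rw [boxLa214M_M15v110, Box.withEntry_of_ne _ _ (by decide)]; rfl)
    (by rw [la214M_v110_U, Entry.encl_ofEnds_fst]; norm_num) (by rw [la214M_M15v19_n, Entry.encl_ofEnds_fst]; norm_num)
    (by rw [la214M_M15v19_n, Entry.encl_ofEnds_snd]; norm_num) (by rw [la214M_M15v19_t, Entry.encl_ofEnds_fst]) (by norm_num)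
    (by rw [la214M_M15v110_s2Lo, la214M_M15v110_s2Hi]; exact sw_afc_la214M_M15v110_word) hΘ hk

/-- **HYPOTHESIS-FREE typed T-axis word on `boxCCOCM_M36`** (Ca₁.₉Na₀.₁CuO₂Cl₂ OBJECT M (#36; tp/t ∈ [−0.237, −0.076], tpp/t ∈ [0.078, 0.179]); `t₁ = 21/50` eV), `t–t′` TRUNCATION of the member (object M carries `t″`; no
thermal `t″` seam): for every temperature cell `Θ` (`0 < kT₁`), `kT ∈ Θ`, member `p`, `β' ≥ p t_eV/kT`, every torus-limit sector-Gibbs state of `H(1, p tp/t, p U/t)` at `β'`: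
**`e(ω) ∈ [-1.6057583347, -0.3867404523 + 1.3863/((21/50)/kT₂)]`** (`T ≤ 300 K`: cap -0.3009218808; `100 K`: -0.3580242380) — the CLOSED `T = 0` word `sw_afc_ccocM_M36_word` through
`holdsOn_thermalAnnex_of_cellWord`. [cite: Israel1979, Thm. I.3.4] [cite: Ruelle1969, §2.5–2.6] -/
theorem boxCCOCM_M36_ttPrimeThermalAnnex_closed {Θ : NonemptyInterval ℚ} (hΘ : 0 < Θ.fst) {kT : ℝ} (hk : kT ∈ Θ.ratCast ℝ) :
    HoldsOn (fun p : OneBandCoord → ℝ => ∀ β' : ℝ, p .tEV / kT ≤ β' →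
      ∀ (ω : InfVolFermionState 2) (Ls : ℕ → ℕ), Tendsto Ls atTop atTop →
        ω.IsTorusLimitOfMixture (sectorGibbsCount (p .filling))
          (fun L => sectorGibbsWeightTT' β' 1 (p .tpOverT) (p .UOverT) (p .filling) L)
          (fun L => sectorGibbsVectorTT' 1 (p .tpOverT) (p .UOverT) (p .filling) L) Ls →
        ω.meanEnergy (hubbardTTPrimeFermionInteraction 1 (p .tpOverT) (p .UOverT)) 1 ∈
          Set.Icc (-1.6057583347 : ℝ) ((-0.3867404523 : ℝ) + 1.3863 / ((((21/50 : ℚ) / Θ.snd : ℚ)) : ℝ))) boxCCOCM_M36 :=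
  holdsOn_thermalAnnex_of_cellWord (B := boxCCOCM_M36) (eU := cCOCM_M36_U) (eS := cCOCM_M36_tp) (eN := cCOCM_M36_n) (eT := cCOCM_M36_t) rfl rfl rfl rfl
    (by rw [cCOCM_M36_U, Entry.encl_ofEnds_fst]; norm_num) (by rw [cCOCM_M36_n, Entry.encl_ofEnds_fst]; norm_num)
    (by rw [cCOCM_M36_n, Entry.encl_ofEnds_snd]; norm_num) (by rw [cCOCM_M36_t, Entry.encl_ofEnds_fst]) (by norm_num)
    (by rw [cCOCM_M36_s2Lo, cCOCM_M36_s2Hi]; exact sw_afc_ccocM_M36_word) hΘ hk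

end Summit.Ventures.CertifiedManyBodySolver.Downfold

end
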